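import Summits.RiemannHypothesis.RiemannHypothesis.Theorems.ThetaTier2RowSound
import HarnessLib

/-!
# THETA tier-2 kernel rows — twin primes `641 ≤ q ≤ 1289` (module 2 of 13; cc-s2-1, WEIL typing lane; RH-FREE bookkeeping)

Data module of the tier-2 theta certificate (THETA-CERT-cc6 §E; HOME/cc-s2-1/gen22/TIER2-KERNEL-SPEC.md; soundness chain
`ThetaTier2Check … ThetaTier2RowSound`): the rows `(q, q⁺, m, δ·10¹², menu, k)` — `m = 5`, `δ = ⌊0.98·δ_q·10¹²⌋/10¹²` with
`δ_q = ½ log(q⁺/q)`, menu `0` = thin seed `(1/20, 19/20, 1)`, `η′ = 1/100` (menu `1` = `(1/4, 3/5, 1)`, `η′ = 1/20` for `q = 179, 191`),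
`t₀ = 2⁻¹⁵`; `K = 6`, `τ = 1/100`, `D = 3`, `W_l = 4`, `J = 64` — for the twin primes `641 ≤ q ≤ 1289` in the range of the route item
`stmt-RiemannHypothesis-19172` (`WallsTenKTwin`, `route-RiemannHypothesis-WeilSemilocal`), checked in the kernel by `Row2.check`
(`decide +kernel`, ≈ 14 s per row), and the resulting REAL statements `T2Valid r.inp r.real ∧ r.RowFacts` (`Row2.check_sound`) that the
E-side assembly turns into `UC(q)`.  Nothing here bears on the truth of RH.
-/

set_option linter.dupNamespace false  -- the mandated namespace repeats `RiemannHypothesis`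

namespace Summit.RiemannHypothesis.RiemannHypothesis.Theorems.ThetaTier2

/-- Twin rows `641 ≤ q ≤ 1019` (8 rows). [this cell, TIER2-KERNEL-SPEC §4] -/
def twinRows02_1 : List Row2 := [
  ⟨641, 643, 5, 1526480985, 0, 15⟩, ⟨659, 661, 5, 1484849621, 0, 15⟩, ⟨809, 811, 5, 1209877157, 0, 15⟩, ⟨821, 823, 5, 1192214700, 0, 15⟩,
  ⟨827, 829, 5, 1183575454, 0, 15⟩, ⟨857, 859, 5, 1142191659, 0, 15⟩, ⟨881, 883, 5, 1111111587, 0, 15⟩, ⟨1019, 1021, 5, 960784621, 0, 15⟩ ]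

/-- The kernel verdict for `twinRows02_1`. [this cell, THETA-CERT-cc6 §E6] -/
theorem twinRows02_1_check : twinRows02_1.all Row2.check = true := by
  decide +kernel

/-- (K1)–(K7) and the row facts at every row of `twinRows02_1`. [this cell, THETA-CERT-cc6 §E6] -/
theorem twinRows02_1_valid : ∀ r ∈ twinRows02_1, T2Valid r.inp r.real ∧ r.RowFacts :=
  fun r hr => r.check_sound (List.all_eq_true.1 twinRows02_1_check r hr)

/-- Twin rows `1031 ≤ q ≤ 1289` (8 rows). [this cell, TIER2-KERNEL-SPEC §4] -/
def twinRows02_2 : List Row2 := [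
  ⟨1031, 1033, 5, 949612700, 0, 15⟩, ⟨1049, 1051, 5, 933333615, 0, 15⟩, ⟨1061, 1063, 5, 922787466, 0, 15⟩, ⟨1091, 1093, 5, 897436148, 0, 15⟩,
  ⟨1151, 1153, 5, 850694658, 0, 15⟩, ⟨1229, 1231, 5, 796748143, 0, 15⟩, ⟨1277, 1279, 5, 766823317, 0, 15⟩, ⟨1289, 1291, 5, 759690074, 0, 15⟩ ]

/-- The kernel verdict for `twinRows02_2`. [this cell, THETA-CERT-cc6 §E6] -/
theorem twinRows02_2_check : twinRows02_2.all Row2.check = true := by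
  decide +kernel

/-- (K1)–(K7) and the row facts at every row of `twinRows02_2`. [this cell, THETA-CERT-cc6 §E6] -/
theorem twinRows02_2_valid : ∀ r ∈ twinRows02_2, T2Valid r.inp r.real ∧ r.RowFacts :=
  fun r hr => r.check_sound (List.all_eq_true.1 twinRows02_2_check r hr)

end Summit.RiemannHypothesis.RiemannHypothesis.Theorems.ThetaTier2
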